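import Literature.Barriers.CriticalPhenomena.LaceExpansionIsingDeconvolutionConvAlgebra
import Literature.Barriers.CriticalPhenomena.LaceExpansionConvolutionBounds
import Literature.Probability.LatticeModels.SharpnessSubcritical
import HarnessLib

/-!
# `x`-space glue for the assembly of Liu–Slade's Theorem 1.7: criticality `F̂_{z_c}(0) = 0`
# from the divergence of the susceptibility

Barrier catalogue `Literature/Barriers/CriticalPhenomena/` (D-0021), companion of
`LaceExpansionIsingDeconvolution.lean` (the named fact `SpreadOutIsing.LiuSlade2026_thm1_7`,
Liu–Slade 2026, Theorem 1.7) and of `LaceExpansionIsingDeconvolutionParts.lean` (its deep inputs as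
named facts). In the printed proof of Theorem 1.7 (Liu–Slade 2026, §2.2) the critical impulse
equation `F_{z_c} * G_{z_c} = δ` (Assumption 1.4 at `z_c`, available once `b(z_c) ≤ 2`) has to be fed
into the deconvolution theorems at criticality, which requires `F̂_{z_c}(0) = Σ_x F_{z_c}(x) = 0`
(so that Assumption 2.1 holds with `F̂_{z_c}(0) ≥ 0` and `μ_{z_c} = 1`; Liu–Slade 2024, Thm. 1.2 is
applied "in the critical case `F̂(0) = 0`"). The source obtains this as "By monotone convergence, we
can take the `z → z_c⁻` limit of (2.15) [`F̂_z(0) = 1/Σ_x G_z(x)`] to see that `F̂_{z_c}(0) = 0`";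
since the coefficient functions `Π_z` of Assumption 1.4 are not asserted to depend continuously on
`z`, the limit has to be taken inside the critical equation itself. This file PROVES the
corresponding `x`-space statement, for an arbitrary absolutely summable kernel `F` with a finite
second moment and a nonnegative solution `G` obeying the bootstrap bound (2.18):

* `tsum_eq_zero_of_latticeConv_eq_delta0` — if `F * G = δ` on `ℤ^d` (`d ≥ 2`), `Σ_x |x|²|F(x)| < ∞`,
  `0 ≤ G(x) ≤ C⟦x⟧^{-(d-2)}` and `Σ_x G(x) = ∞`, then `Σ_x F(x) = 0`.

Proof (elementary): pair the equation with the tent `w_R(x) = (1 - ‖x‖_∞/R)₊`: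
`1 = Σ_x w_R(x)(F*G)(x) = F̂(0)·A_R + Σ_y F(y)(A_R(y) - A_R)` with `A_R(y) = Σ_x w_R(x)G(x-y)`,
`A_R = A_R(0) ≥ ½ Σ_{Λ_{R/2}} G`; the tent is `1/R`-Lipschitz in `‖·‖_∞`, so
`|A_R(y) - A_R| ≤ (‖y‖_∞/R) g(3R)` for `‖y‖_∞ ≤ R` (`g(R) = Σ_{Λ_R} G`), while cube sums of
`⟦x⟧^{-(d-2)}` give `A_R(y), A_R = O(R²)` for the remaining `y`; hence
`|F̂(0)| g(n) ≤ c₀ + (M/n) g(6n)`. If `F̂(0) ≠ 0`, the a priori `g(6n) = O(n²)` yields `g(n) = O(n)`,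
and feeding this back yields `g` bounded, contradicting `Σ G = ∞`.

## References

* Y. Liu, G. Slade, *Gaussian deconvolution and the lace expansion for spread-out models*,
  Ann. Inst. H. Poincaré Probab. Statist. 62 (2026), arXiv:2310.07640: Assumption 1.3(i)
  (`Σ_x G_{z_c}(x) = ∞`), Assumption 2.1 (`F̂_z(0) ≥ 0`), (2.4) (`μ_z = 1 - λ_z F̂_z(0)`), §2.2:
  (2.15), (2.18), and the proof of Thm. 1.7 ("`F̂_{z_c}(0) = 0`", "Since `F̂_{z_c}(0) = 0`, …
  `μ_{z_c} = 1`") [LiuSlade2026]. Equation numbers are those of the arXiv version held in the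
  literature store.
* Y. Liu, G. Slade, *Gaussian deconvolution and the lace expansion*, Probab. Theory Related
  Fields (2024), Thm. 1.2 ("In the critical case, using `μ = 1` …") [LiuSlade2024].
-/

noncomputable section

namespace Literature.Barriers.CriticalPhenomena.SpreadOutIsing

open Filter Finset Literature.Probability.LatticeModels
open _root_.Topology
open scoped BigOperators

variable {d : ℕ}

/-! ## Part A. Cube sums of a nonnegative function with the bootstrap decay `⟦x⟧^{-(d-2)}` -/

section CubeSums

variable {G : Site d → ℝ} {C : ℝ}

/-- `‖x - y‖_∞ ≤ ‖x‖_∞ + ‖y‖_∞`. [folklore] -/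
theorem supNorm_sub_le_add (x y : Site d) : Site.supNorm (x - y) ≤ Site.supNorm x + Site.supNorm y := by
  have h := Site.supNorm_add_le x (-y)
  rwa [← sub_eq_add_neg, Site.supNorm_neg] at h

/-- The translate of a cube sum is a sum over the translated cube, which lies in a larger cube:
`Σ_{x ∈ Λ_R} G(x - y) ≤ Σ_{Λ_{R + ‖y‖_∞}} G` for `G ≥ 0`. [folklore] -/
theorem sum_box_shift_le (hG0 : ∀ x, 0 ≤ G x) (R : ℕ) (y : Site d) :
    ∑ x ∈ box d R, G (x - y) ≤ ∑ u ∈ box d (R + Site.supNorm y), G u := by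
  classical
  rw [← Finset.sum_image (s := box d R) (g := fun x => x - y) (f := G)
    fun x _ x' _ h => sub_left_injective h]
  refine Finset.sum_le_sum_of_subset_of_nonneg (fun u hu => ?_) fun u _ _ => hG0 u
  obtain ⟨x, hx, rfl⟩ := Finset.mem_image.1 hu
  rw [mem_box_iff_supNorm_le] at hx ⊢
  exact (supNorm_sub_le_add x y).trans (by omega)

/-- Conversely `Σ_{Λ_{R - ‖y‖_∞}} G ≤ Σ_{x ∈ Λ_R} G(x - y)` for `G ≥ 0` and `‖y‖_∞ ≤ R`. [folklore] -/
theorem sum_box_le_sum_box_shift (hG0 : ∀ x, 0 ≤ G x) {R : ℕ} {y : Site d} (hy : Site.supNorm y ≤ R) :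
    ∑ u ∈ box d (R - Site.supNorm y), G u ≤ ∑ x ∈ box d R, G (x - y) := by
  classical
  rw [← Finset.sum_image (s := box d R) (g := fun x => x - y) (f := G)
    fun x _ x' _ h => sub_left_injective h]
  refine Finset.sum_le_sum_of_subset_of_nonneg (fun u hu => ?_) fun u _ _ => hG0 u
  rw [mem_box_iff_supNorm_le] at hu
  refine Finset.mem_image.2 ⟨u + y, ?_, add_sub_cancel_right u y⟩
  rw [mem_box_iff_supNorm_le]
  exact (Site.supNorm_add_le u y).trans (by omega)

/-- **Translated cube sums under the bootstrap decay**: if `0 ≤ G(x) ≤ C⟦x⟧^{-(d-2)}` (`d ≥ 2`),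
then `Σ_{x ∈ Λ_R} G(x - y) ≤ C(2 + 2d·3^{d-1} + 2^d)(R+1)²` for every `y` (split according to
whether `x - y ∈ Λ_R`: the lattice partial sums `Σ_{Λ_R} ⟦u⟧^{-(d-2)} ≤ 1 + 2d3^{d-1}R²`, and at most
`(2R+1)^d` terms each `≤ (R+1)^{-(d-2)}`). [cite: LiuSlade2026, (2.18)] -/
theorem sum_box_shift_le_sq (hd : 2 ≤ d) (hG0 : ∀ x, 0 ≤ G x)
    (hGle : ∀ x, G x ≤ C * jnorm x ^ (-((d : ℝ) - 2))) (R : ℕ) (y : Site d) :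
    ∑ x ∈ box d R, G (x - y) ≤ C * (2 + 2 * d * 3 ^ (d - 1) + 2 ^ d) * ((R : ℝ) + 1) ^ 2 := by
  classical
  have hC : 0 ≤ C := by
    have h := (hG0 0).trans (hGle 0)
    rwa [jnorm_zero, Real.one_rpow, mul_one] at h
  set f : Site d → ℝ := fun u => jnorm u ^ (-((d : ℝ) - 2)) with hf
  have hf0 : ∀ u, 0 ≤ f u := fun u => Real.rpow_nonneg (jnorm_pos u).le _
  -- reduce to the weight `f`
  have h1 : ∑ x ∈ box d R, G (x - y) ≤ C * ∑ x ∈ box d R, f (x - y) := by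
    rw [Finset.mul_sum]; exact Finset.sum_le_sum fun x _ => hGle _
  refine h1.trans ?_
  rw [mul_assoc]
  refine mul_le_mul_of_nonneg_left ?_ hC
  -- split the cube according to `x - y ∈ Λ_R`
  rw [← Finset.sum_filter_add_sum_filter_not (box d R) (fun x => x - y ∈ box d R)]
  have hA : ∑ x ∈ (box d R).filter (fun x => x - y ∈ box d R), f (x - y) ≤
      1 + 2 * d * 3 ^ (d - 1) * (R : ℝ) ^ ((d : ℝ) - ((d : ℝ) - 2)) := by
    rw [← Finset.sum_image (s := (box d R).filter (fun x => x - y ∈ box d R)) (g := fun x => x - y)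
      (f := f) fun x _ x' _ h => sub_left_injective h]
    refine (Finset.sum_le_sum_of_subset_of_nonneg (fun u hu => ?_) fun u _ _ => hf0 u).trans
      (sum_box_jnorm_rpow_neg_le (by omega) (by
        have : (2 : ℝ) ≤ d := by exact_mod_cast hd
        linarith) (by linarith) R)
    obtain ⟨x, hx, rfl⟩ := Finset.mem_image.1 hu
    exact (Finset.mem_filter.1 hx).2
  have hB : ∑ x ∈ (box d R).filter (fun x => ¬x - y ∈ box d R), f (x - y) ≤
      (2 * (R : ℝ) + 1) ^ d * ((R : ℝ) + 1) ^ (-((d : ℝ) - 2)) := by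
    have hterm : ∀ x ∈ (box d R).filter (fun x => ¬x - y ∈ box d R),
        f (x - y) ≤ ((R : ℝ) + 1) ^ (-((d : ℝ) - 2)) := by
      intro x hx
      have hx' : R + 1 ≤ Site.supNorm (x - y) := by
        have := (Finset.mem_filter.1 hx).2
        rw [mem_box_iff_supNorm_le] at this
        omega
      have hj : (R : ℝ) + 1 ≤ jnorm (x - y) := by
        have := supNorm_le_jnorm (x - y)
        exact le_trans (by exact_mod_cast hx') this
      have hd2 : 0 ≤ (d : ℝ) - 2 := by
        have : (2 : ℝ) ≤ d := by exact_mod_cast hd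
        linarith
      exact Real.rpow_le_rpow_of_nonpos (by positivity) hj (by linarith)
    refine (Finset.sum_le_sum hterm).trans ?_
    rw [Finset.sum_const, nsmul_eq_mul]
    refine mul_le_mul_of_nonneg_right ?_ (Real.rpow_nonneg (by positivity) _)
    have := Finset.card_filter_le (box d R) (fun x => ¬x - y ∈ box d R)
    rw [card_box] at this
    exact_mod_cast this
  -- numerics
  have hR : (0 : ℝ) ≤ R := Nat.cast_nonneg R
  have hdexp : (d : ℝ) - ((d : ℝ) - 2) = 2 := by ring
  rw [hdexp] at hA
  have hA' : 1 + 2 * d * 3 ^ (d - 1) * (R : ℝ) ^ (2 : ℝ) ≤ (1 + 2 * d * 3 ^ (d - 1)) * ((R : ℝ) + 1) ^ 2 := by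
    rw [Real.rpow_two]
    have h3 : (0 : ℝ) ≤ 2 * d * 3 ^ (d - 1) := by positivity
    nlinarith [mul_nonneg h3 (by nlinarith : (0 : ℝ) ≤ (R + 1) ^ 2 - R ^ 2),
      (by nlinarith : (1 : ℝ) ≤ (R + 1) ^ 2)]
  have hB' : (2 * (R : ℝ) + 1) ^ d * ((R : ℝ) + 1) ^ (-((d : ℝ) - 2)) ≤ 2 ^ d * ((R : ℝ) + 1) ^ 2 := by
    have hR1 : (0 : ℝ) < R + 1 := by linarith
    have h2 : (2 * (R : ℝ) + 1) ^ d ≤ (2 * ((R : ℝ) + 1)) ^ d :=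
      pow_le_pow_left₀ (by linarith) (by linarith) d
    rw [mul_pow] at h2
    have hpow : ((R : ℝ) + 1) ^ d * ((R : ℝ) + 1) ^ (-((d : ℝ) - 2)) = ((R : ℝ) + 1) ^ 2 := by
      rw [← Real.rpow_natCast, ← Real.rpow_add hR1, ← Real.rpow_two]
      norm_num
    calc (2 * (R : ℝ) + 1) ^ d * ((R : ℝ) + 1) ^ (-((d : ℝ) - 2))
        ≤ (2 ^ d * ((R : ℝ) + 1) ^ d) * ((R : ℝ) + 1) ^ (-((d : ℝ) - 2)) :=
          mul_le_mul_of_nonneg_right h2 (Real.rpow_nonneg hR1.le _)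
      _ = 2 ^ d * ((R : ℝ) + 1) ^ 2 := by rw [mul_assoc, hpow]
  calc ∑ x ∈ (box d R).filter (fun x => x - y ∈ box d R), f (x - y) +
        ∑ x ∈ (box d R).filter (fun x => ¬x - y ∈ box d R), f (x - y)
      ≤ (1 + 2 * d * 3 ^ (d - 1)) * ((R : ℝ) + 1) ^ 2 + 2 ^ d * ((R : ℝ) + 1) ^ 2 :=
        add_le_add (hA.trans hA') (hB.trans hB')
    _ ≤ (2 + 2 * d * 3 ^ (d - 1) + 2 ^ d) * ((R : ℝ) + 1) ^ 2 := by nlinarith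

end CubeSums

/-! ## Part B. The tent-weighted equation and its error term -/

section Tent

variable {F G : Site d → ℝ}

/-- Summing `F * G = δ` against a finitely supported weight: for `F ∈ ℓ¹`, `G` bounded and any
finite set `S ∋ 0`, `Σ_{x ∈ S} w(x)(F*G)(x) = Σ_y F(y) Σ_{x ∈ S} w(x) G(x - y)`, and the left side
is `w(0)` when `F * G = δ`. [folklore] -/
theorem tsum_mul_sum_shift_eq (hF : Summable fun y => |F y|) {M : ℝ} (hGb : ∀ x, |G x| ≤ M)
    (hconv : ∀ x, latticeConv F G x = delta0 x) (S : Finset (Site d)) (hS : (0 : Site d) ∈ S)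
    (w : Site d → ℝ) :
    ∑' y, F y * ∑ x ∈ S, w x * G (x - y) = w 0 := by
  classical
  have hterm : ∀ x, Summable fun y => F y * G (x - y) := summable_latticeConv_term_of_bdd hF hGb
  calc ∑' y, F y * ∑ x ∈ S, w x * G (x - y)
      = ∑' y, ∑ x ∈ S, w x * (F y * G (x - y)) := by
        refine tsum_congr fun y => ?_
        rw [Finset.mul_sum]
        exact Finset.sum_congr rfl fun x _ => by ring
    _ = ∑ x ∈ S, ∑' y, w x * (F y * G (x - y)) :=
        Summable.tsum_finsetSum fun x _ => (hterm x).mul_left (w x)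
    _ = ∑ x ∈ S, w x * latticeConv F G x := by
        refine Finset.sum_congr rfl fun x _ => ?_
        rw [tsum_mul_left]; rfl
    _ = ∑ x ∈ S, w x * delta0 x := by simp_rw [hconv]
    _ = w 0 := by
        rw [Finset.sum_eq_single_of_mem 0 hS fun x _ hx => by rw [delta0_of_ne_zero hx, mul_zero]]
        simp

/-- The tent `w_R(x) = (1 - ‖x‖_∞/R)₊` is `1/R`-Lipschitz for the sup norm:
`|w_R(x) - w_R(x - y)| ≤ ‖y‖_∞/R`. [folklore] -/
theorem abs_tent_sub_tent_le {R : ℝ} (hR : 0 < R) (x y : Site d) :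
    |max (1 - Site.supNorm x / R) 0 - max (1 - Site.supNorm (x - y) / R) 0| ≤ Site.supNorm y / R := by
  refine (abs_max_sub_max_le_abs _ _ _).trans ?_
  rw [show (1 - Site.supNorm x / R) - (1 - Site.supNorm (x - y) / R) =
    ((Site.supNorm (x - y) : ℝ) - Site.supNorm x) / R by ring, abs_div, abs_of_pos hR]
  refine div_le_div_of_nonneg_right ?_ hR.le
  rw [abs_sub_le_iff]
  constructor
  · have := supNorm_sub_le_add x y
    have h' : (Site.supNorm (x - y) : ℝ) ≤ Site.supNorm x + Site.supNorm y := by exact_mod_cast this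
    linarith
  · have := Site.supNorm_le_supNorm_sub_add x y
    have h' : (Site.supNorm x : ℝ) ≤ Site.supNorm (x - y) + Site.supNorm y := by exact_mod_cast this
    linarith

/-- **The error term for small lags.** With `w_R` the tent, `A_R(y) = Σ_{x ∈ Λ_{R+‖y‖}} w_R(x)G(x-y)`
and `G ≥ 0`: for `‖y‖_∞ ≤ R`,
`|Σ_{x ∈ Λ_{R+‖y‖}} w_R(x) G(x - y) - Σ_{x ∈ Λ_{R+‖y‖}} w_R(x - y) G(x - y)| ≤ (‖y‖_∞/R) Σ_{Λ_{3R}} G`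
(the tent is `1/R`-Lipschitz and the translated cube lies in `Λ_{R + 2‖y‖} ⊆ Λ_{3R}`). [folklore] -/
theorem abs_sum_tent_sub_le (hG0 : ∀ x, 0 ≤ G x) {R : ℕ} (hR : 1 ≤ R) {y : Site d}
    (hy : Site.supNorm y ≤ R) :
    |∑ x ∈ box d (R + Site.supNorm y), max (1 - Site.supNorm x / (R : ℝ)) 0 * G (x - y) -
        ∑ x ∈ box d (R + Site.supNorm y), max (1 - Site.supNorm (x - y) / (R : ℝ)) 0 * G (x - y)| ≤
      Site.supNorm y / (R : ℝ) * ∑ u ∈ box d (3 * R), G u := by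
  have hRpos : (0 : ℝ) < R := by exact_mod_cast hR
  rw [← Finset.sum_sub_distrib]
  refine (Finset.abs_sum_le_sum_abs _ _).trans ?_
  have hpt : ∀ x ∈ box d (R + Site.supNorm y),
      |max (1 - Site.supNorm x / (R : ℝ)) 0 * G (x - y) - max (1 - Site.supNorm (x - y) / (R : ℝ)) 0 * G (x - y)|
        ≤ Site.supNorm y / (R : ℝ) * G (x - y) := by
    intro x _
    rw [← sub_mul, abs_mul, abs_of_nonneg (hG0 _)]
    exact mul_le_mul_of_nonneg_right (abs_tent_sub_tent_le hRpos x y) (hG0 _)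
  refine (Finset.sum_le_sum hpt).trans ?_
  rw [← Finset.mul_sum]
  refine mul_le_mul_of_nonneg_left ((sum_box_shift_le hG0 _ y).trans ?_) (by positivity)
  refine Finset.sum_le_sum_of_subset_of_nonneg (box_mono d (by omega)) fun u _ _ => hG0 u

end Tent

/-! ## Part C. Criticality: `Σ_x F(x) = 0` -/

section Critical

variable {F G : Site d → ℝ} {C : ℝ}

/-- **`F̂(0) = 0` for the critical impulse equation.** Let `d ≥ 2`, `F ∈ ℓ¹(ℤ^d)` with
`Σ_x ‖x‖²|F(x)| < ∞`, and let `G ≥ 0` satisfy the bootstrap bound `G(x) ≤ C⟦x⟧^{-(d-2)}` ((2.18))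
and `Σ_x G(x) = ∞` (Assumption 1.3(i)). If `F * G = δ`, then `Σ_x F(x) = 0`. This is the step
"`F̂_{z_c}(0) = 0`" of the proof of Theorem 1.7, in a form that uses the critical equation only
(the source takes "the `z → z_c⁻` limit of (2.15)"). Proof: with the tent `w_R = (1 - ‖·‖_∞/R)₊`,
`1 = Σ_y F(y) Σ_x w_R(x)G(x-y)` (`tsum_mul_sum_shift_eq`), and
`|Σ_x w_R(x)G(x-y) - Σ_u w_R(u)G(u)| ≤ (‖y‖/R)·g(3R) + (‖y‖²/R²)·O(R²)` (`abs_sum_tent_sub_le`,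
`sum_box_shift_le_sq`), whence `|Σ F| g(n) ≤ c₀ + (M/n) g(6n)` for `g(n) = Σ_{Λ_n} G`; if `Σ F ≠ 0`
this gives `g(n) = O(n)` and then `g = O(1)`, contradicting `Σ G = ∞`.
[cite: LiuSlade2026, §2.2, proof of Theorem 1.7 ("F̂_{z_c}(0) = 0"; (2.15), (2.18)) and Assumption 1.3(i)] -/
theorem tsum_eq_zero_of_latticeConv_eq_delta0 (hd : 2 ≤ d) (hF : Summable fun y => |F y|)
    (hF2 : Summable fun y => euclidNorm y ^ 2 * |F y|) (hG0 : ∀ x, 0 ≤ G x)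
    (hGle : ∀ x, G x ≤ C * jnorm x ^ (-((d : ℝ) - 2))) (hGns : ¬Summable G)
    (hconv : ∀ x, latticeConv F G x = delta0 x) : ∑' y, F y = 0 := by
  classical
  by_contra hs
  set s : ℝ := ∑' y, F y with hsdef
  have hspos : 0 < |s| := abs_pos.2 hs
  -- constants
  have hC : 0 ≤ C := by
    have h := (hG0 0).trans (hGle 0)
    rwa [jnorm_zero, Real.one_rpow, mul_one] at h
  set CG : ℝ := C * (2 + 2 * d * 3 ^ (d - 1) + 2 ^ d) with hCG
  have hCG0 : 0 ≤ CG := by positivity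
  -- `G` is bounded by `C`
  have hGb : ∀ x, |G x| ≤ C := by
    intro x
    rw [abs_of_nonneg (hG0 x)]
    refine (hGle x).trans ?_
    have : jnorm x ^ (-((d : ℝ) - 2)) ≤ 1 := by
      refine Real.rpow_le_one_of_one_le_of_nonpos (one_le_jnorm x) ?_
      have : (2 : ℝ) ≤ d := by exact_mod_cast hd
      linarith
    exact mul_le_of_le_one_right hC this
  -- the second moment in the sup norm: `M = Σ ‖y‖_∞² |F(y)|`
  set m : Site d → ℝ := fun y => (Site.supNorm y : ℝ) with hm
  have hm0 : ∀ y, 0 ≤ m y := fun y => Nat.cast_nonneg _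
  have hm_le_sq : ∀ y, m y ≤ m y ^ 2 := by
    intro y
    rcases Nat.eq_zero_or_pos (Site.supNorm y) with h | h
    · simp [hm, h]
    · have : (1 : ℝ) ≤ m y := by simp only [hm]; exact_mod_cast h
      nlinarith
  have hMs : Summable fun y => m y ^ 2 * |F y| := by
    refine Summable.of_nonneg_of_le (fun y => by positivity) (fun y => ?_) hF2
    have hsup : (Site.supNorm y : ℝ) ≤ euclidNorm y := by
      rw [← Site.norm_eq_supNorm]; exact norm_le_euclidNorm y
    exact mul_le_mul_of_nonneg_right (pow_le_pow_left₀ (hm0 y) hsup 2) (abs_nonneg _)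
  set M : ℝ := ∑' y, m y ^ 2 * |F y| with hMdef
  have hM0 : 0 ≤ M := tsum_nonneg fun y => by positivity
  -- cube partial sums `g n = Σ_{Λ_n} G`
  set g : ℕ → ℝ := fun n => ∑ u ∈ box d n, G u with hg
  have hg0 : ∀ n, 0 ≤ g n := fun n => Finset.sum_nonneg fun u _ => hG0 u
  have hgmono : Monotone g := fun a b hab =>
    Finset.sum_le_sum_of_subset_of_nonneg (box_mono d hab) fun u _ _ => hG0 u
  have hgsq : ∀ n : ℕ, g n ≤ CG * ((n : ℝ) + 1) ^ 2 := by
    intro n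
    have := sum_box_shift_le_sq hd hG0 hGle n 0
    simpa only [sub_zero] using this
  -- ### the key inequality: `|s| g(n) ≤ c₀ + (M/n) g(6n)` for `n ≥ 1`
  have key : ∀ n : ℕ, 1 ≤ n → |s| * g n ≤ 2 + 32 * CG * M + M / n * g (6 * n) := by
    intro n hn
    set R : ℕ := 2 * n with hR
    have hR1 : 1 ≤ R := by omega
    have hRpos : (0 : ℝ) < R := by exact_mod_cast hR1
    have hnpos : (0 : ℝ) < n := by exact_mod_cast hn
    -- the tent and the weighted sums
    set w : Site d → ℝ := fun x => max (1 - Site.supNorm x / (R : ℝ)) 0 with hw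
    have hw0 : ∀ x, 0 ≤ w x := fun x => le_max_right _ _
    have hw1 : ∀ x, w x ≤ 1 := fun x => max_le (by
      have : (0 : ℝ) ≤ Site.supNorm x / R := by positivity
      linarith) zero_le_one
    have hw_out : ∀ x, x ∉ box d R → w x = 0 := by
      intro x hx
      rw [mem_box_iff_supNorm_le, not_le] at hx
      have : (1 : ℝ) - Site.supNorm x / R ≤ 0 := by
        rw [sub_nonpos, le_div_iff₀ hRpos, one_mul]; exact_mod_cast hx.le
      simp only [hw]; exact max_eq_right this
    set A : ℝ := ∑ u ∈ box d R, w u * G u with hA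
    -- (i) the tent-weighted equation: `Σ_y F(y) A_R(y) = 1`
    set AR : Site d → ℝ := fun y => ∑ x ∈ box d R, w x * G (x - y) with hAR
    have heq1 : ∑' y, F y * AR y = 1 := by
      have := tsum_mul_sum_shift_eq hF hGb hconv (box d R) (zero_mem_box d R) w
      rw [this]
      have h00 : Site.supNorm (0 : Site d) = 0 := Site.supNorm_eq_zero_iff.2 rfl
      simp [hw, h00]
    -- (ii) `A ≥ g(n)/2`
    have hA_ge : g n / 2 ≤ A := by
      have h1 : ∑ u ∈ box d n, (1 / 2 : ℝ) * G u ≤ ∑ u ∈ box d n, w u * G u := by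
        refine Finset.sum_le_sum fun u hu => mul_le_mul_of_nonneg_right ?_ (hG0 u)
        rw [mem_box_iff_supNorm_le] at hu
        refine le_max_of_le_left ?_
        have : (Site.supNorm u : ℝ) / R ≤ 1 / 2 := by
          rw [div_le_div_iff₀ hRpos two_pos, hR]; push_cast
          have : (Site.supNorm u : ℝ) ≤ n := by exact_mod_cast hu
          linarith
        linarith
      have h2 : ∑ u ∈ box d n, w u * G u ≤ A :=
        Finset.sum_le_sum_of_subset_of_nonneg (box_mono d (by omega)) fun u _ _ =>
          mul_nonneg (hw0 u) (hG0 u)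
      rw [← Finset.mul_sum] at h1
      have : (1 / 2 : ℝ) * g n = g n / 2 := by ring
      linarith
    -- (iii) the error bound, pointwise in `y`
    have herr : ∀ y, |AR y - A| ≤ m y / R * g (3 * R) + m y ^ 2 / (R : ℝ) ^ 2 * (2 * CG * ((R : ℝ) + 1) ^ 2) := by
      intro y
      have hARle : AR y ≤ CG * ((R : ℝ) + 1) ^ 2 := by
        calc AR y ≤ ∑ x ∈ box d R, G (x - y) :=
              Finset.sum_le_sum fun x _ => mul_le_of_le_one_left (hG0 _) (hw1 x)
          _ ≤ CG * ((R : ℝ) + 1) ^ 2 := sum_box_shift_le_sq hd hG0 hGle R y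
      have hAle : A ≤ CG * ((R : ℝ) + 1) ^ 2 := by
        calc A ≤ ∑ x ∈ box d R, G x :=
              Finset.sum_le_sum fun x _ => mul_le_of_le_one_left (hG0 _) (hw1 x)
          _ ≤ CG * ((R : ℝ) + 1) ^ 2 := hgsq R
      have hAR0 : 0 ≤ AR y := Finset.sum_nonneg fun x _ => mul_nonneg (hw0 x) (hG0 _)
      have hA0 : 0 ≤ A := Finset.sum_nonneg fun x _ => mul_nonneg (hw0 x) (hG0 _)
      have h2CG : 0 ≤ 2 * CG * ((R : ℝ) + 1) ^ 2 := mul_nonneg (mul_nonneg zero_le_two hCG0) (sq_nonneg _)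
      have ht1 : 0 ≤ m y / R * g (3 * R) := mul_nonneg (div_nonneg (hm0 y) hRpos.le) (hg0 _)
      have ht2 : 0 ≤ m y ^ 2 / (R : ℝ) ^ 2 * (2 * CG * ((R : ℝ) + 1) ^ 2) :=
        mul_nonneg (div_nonneg (sq_nonneg _) (sq_nonneg _)) h2CG
      by_cases hy : Site.supNorm y ≤ R
      · -- small lags: Lipschitz estimate
        have hbig : AR y = ∑ x ∈ box d (R + Site.supNorm y), w x * G (x - y) := by
          refine Finset.sum_subset (box_mono d (by omega)) fun x _ hx => ?_
          rw [hw_out x hx, zero_mul]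
        have hbigA : A = ∑ x ∈ box d (R + Site.supNorm y), w (x - y) * G (x - y) := by
          rw [← Finset.sum_image (s := box d (R + Site.supNorm y)) (g := fun x => x - y)
            (f := fun u => w u * G u) fun x _ x' _ h => sub_left_injective h]
          refine Finset.sum_subset (fun u hu => ?_) fun u _ hu => ?_
          · refine Finset.mem_image.2 ⟨u + y, ?_, add_sub_cancel_right u y⟩
            rw [mem_box_iff_supNorm_le] at hu ⊢
            exact (Site.supNorm_add_le u y).trans (by omega)
          · rw [hw_out u hu, zero_mul]
        have := abs_sum_tent_sub_le hG0 hR1 hy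
        rw [← hbig, ← hbigA] at this
        linarith
      · -- large lags: both sums are `O(R²)` and `‖y‖ > R`
        rw [not_le] at hy
        have hmy : (R : ℝ) ^ 2 ≤ m y ^ 2 := by
          have : (R : ℝ) ≤ m y := by simp only [hm]; exact_mod_cast hy.le
          exact pow_le_pow_left₀ hRpos.le this 2
        have hfrac : 1 ≤ m y ^ 2 / (R : ℝ) ^ 2 := by rwa [le_div_iff₀ (pow_pos hRpos 2), one_mul]
        have habs : |AR y - A| ≤ 2 * CG * ((R : ℝ) + 1) ^ 2 := by
          rw [abs_sub_le_iff]; constructor <;> linarith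
        calc |AR y - A| ≤ 1 * (2 * CG * ((R : ℝ) + 1) ^ 2) := by linarith
          _ ≤ m y ^ 2 / (R : ℝ) ^ 2 * (2 * CG * ((R : ℝ) + 1) ^ 2) :=
              mul_le_mul_of_nonneg_right hfrac h2CG
          _ ≤ m y / R * g (3 * R) + m y ^ 2 / (R : ℝ) ^ 2 * (2 * CG * ((R : ℝ) + 1) ^ 2) := by
              linarith
    -- (iv) sum the error bound: `|1 - s A| ≤ M (g(3R)/R + 2 CG (R+1)²/R²)`
    set K : ℝ := g (3 * R) / R + 2 * CG * ((R : ℝ) + 1) ^ 2 / (R : ℝ) ^ 2 with hK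
    have hK0 : 0 ≤ K :=
      add_nonneg (div_nonneg (hg0 _) hRpos.le)
        (div_nonneg (mul_nonneg (mul_nonneg zero_le_two hCG0) (sq_nonneg _)) (sq_nonneg _))
    have herr' : ∀ y, |AR y - A| ≤ K * m y ^ 2 := by
      intro y
      refine (herr y).trans ?_
      have h1 : m y / R * g (3 * R) ≤ m y ^ 2 / R * g (3 * R) := by
        gcongr
        · exact hg0 _
        · exact hm_le_sq y
      have : m y ^ 2 / R * g (3 * R) + m y ^ 2 / (R : ℝ) ^ 2 * (2 * CG * ((R : ℝ) + 1) ^ 2) =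
          K * m y ^ 2 := by rw [hK]; ring
      linarith
    have hFAR : Summable fun y => F y * AR y :=
      Summable.of_norm_bounded (hF.mul_right (CG * ((R : ℝ) + 1) ^ 2)) fun y => by
        rw [Real.norm_eq_abs, abs_mul]
        refine mul_le_mul_of_nonneg_left ?_ (abs_nonneg _)
        rw [abs_of_nonneg (Finset.sum_nonneg fun x _ => mul_nonneg (hw0 x) (hG0 _))]
        calc AR y ≤ ∑ x ∈ box d R, G (x - y) :=
              Finset.sum_le_sum fun x _ => mul_le_of_le_one_left (hG0 _) (hw1 x)
          _ ≤ CG * ((R : ℝ) + 1) ^ 2 := sum_box_shift_le_sq hd hG0 hGle R y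
    have hbound : |1 - s * A| ≤ K * M := by
      have h1 : 1 - s * A = ∑' y, F y * (AR y - A) := by
        rw [← heq1, hsdef, ← tsum_mul_right, ← hFAR.tsum_sub (hF.of_abs.mul_right A)]
        exact tsum_congr fun y => by ring
      rw [h1]
      have hsumd : Summable fun y => K * (m y ^ 2 * |F y|) := hMs.mul_left K
      have habs_s : Summable fun y => |F y * (AR y - A)| := by
        refine Summable.of_nonneg_of_le (fun y => abs_nonneg _) (fun y => ?_) hsumd
        rw [abs_mul]
        nlinarith [herr' y, abs_nonneg (F y), mul_nonneg hK0 (sq_nonneg (m y))]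
      refine (abs_tsum_le_tsum_abs habs_s).trans ?_
      refine (habs_s.tsum_le_tsum (fun y => ?_) hsumd).trans (le_of_eq ?_)
      · rw [abs_mul]
        nlinarith [herr' y, abs_nonneg (F y), mul_nonneg hK0 (sq_nonneg (m y))]
      · rw [tsum_mul_left]
    -- (v) conclude the key inequality
    have hsA : |s| * A ≤ 1 + K * M := by
      have hA0 : 0 ≤ A := Finset.sum_nonneg fun x _ => mul_nonneg (hw0 x) (hG0 _)
      have : |s| * A = |s * A| := by rw [abs_mul, abs_of_nonneg hA0]
      rw [this]
      have := abs_sub_abs_le_abs_sub (s * A) 1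
      rw [abs_one, abs_sub_comm] at this
      linarith
    have hKle : K * M ≤ 8 * CG * M + M / n * g (6 * n) / 2 := by
      have hR2 : ((R : ℝ) + 1) ^ 2 / (R : ℝ) ^ 2 ≤ 4 := by
        rw [div_le_iff₀ (pow_pos hRpos 2)]
        have : (1 : ℝ) ≤ R := by exact_mod_cast hR1
        nlinarith
      have h3R : g (3 * R) / R = g (6 * n) / n / 2 := by
        rw [hR]; push_cast
        rw [show 3 * (2 * n) = 6 * n by ring]
        ring
      have h2 : 2 * CG * ((R : ℝ) + 1) ^ 2 / (R : ℝ) ^ 2 ≤ 8 * CG := by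
        rw [mul_div_assoc]
        nlinarith [mul_le_mul_of_nonneg_left hR2 (mul_nonneg zero_le_two hCG0)]
      calc K * M = (g (3 * R) / R + 2 * CG * ((R : ℝ) + 1) ^ 2 / (R : ℝ) ^ 2) * M := rfl
        _ ≤ (g (6 * n) / n / 2 + 8 * CG) * M := by
            rw [h3R]; exact mul_le_mul_of_nonneg_right (by linarith) hM0
        _ = 8 * CG * M + M / n * g (6 * n) / 2 := by ring
    calc |s| * g n = 2 * (|s| * (g n / 2)) := by ring
      _ ≤ 2 * (|s| * A) := by gcongr
      _ ≤ 2 * (1 + K * M) := by linarith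
      _ ≤ 2 + 32 * CG * M + M / n * g (6 * n) := by
          have : 0 ≤ CG * M := mul_nonneg hCG0 hM0
          linarith
  -- ### Round 1: `g(n) = O(n)`
  set c₀ : ℝ := 2 + 32 * CG * M with hc₀
  have hCGM : 0 ≤ CG * M := mul_nonneg hCG0 hM0
  have hc₀0 : 0 ≤ c₀ := by rw [hc₀]; linarith
  set A₁ : ℝ := (c₀ + 49 * CG * M) / |s| with hA₁
  have hA₁0 : 0 ≤ A₁ := div_nonneg (by linarith) hspos.le
  have round1 : ∀ n : ℕ, 1 ≤ n → g n ≤ A₁ * n := by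
    intro n hn
    have hn1 : (1 : ℝ) ≤ n := by exact_mod_cast hn
    have h6 : g (6 * n) ≤ 49 * CG * (n : ℝ) ^ 2 := by
      refine (hgsq (6 * n)).trans ?_
      push_cast
      nlinarith [mul_nonneg hCG0 (by nlinarith : (0 : ℝ) ≤ 13 * (n : ℝ) ^ 2 - 12 * n - 1)]
    have hk := key n hn
    have hnpos : (0 : ℝ) < n := by exact_mod_cast hn
    have h1 : M / n * g (6 * n) ≤ 49 * CG * M * n := by
      calc M / n * g (6 * n) ≤ M / n * (49 * CG * (n : ℝ) ^ 2) :=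
            mul_le_mul_of_nonneg_left h6 (div_nonneg hM0 hnpos.le)
        _ = 49 * CG * M * n := by
            rw [div_mul_eq_mul_div, div_eq_iff hnpos.ne']; ring
    have h2 : |s| * g n ≤ (c₀ + 49 * CG * M) * n := by
      have : c₀ ≤ c₀ * n := le_mul_of_one_le_right hc₀0 hn1
      linarith
    rw [hA₁, div_mul_eq_mul_div, le_div_iff₀ hspos]
    linarith
  -- ### Round 2: `g` is bounded
  set B : ℝ := (c₀ + 6 * M * A₁) / |s| with hB
  have round2 : ∀ n : ℕ, 1 ≤ n → g n ≤ B := by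
    intro n hn
    have hnpos : (0 : ℝ) < n := by exact_mod_cast hn
    have h6 : g (6 * n) ≤ A₁ * (6 * n : ℕ) := round1 (6 * n) (by omega)
    have hk := key n hn
    have h1 : M / n * g (6 * n) ≤ 6 * M * A₁ := by
      calc M / n * g (6 * n) ≤ M / n * (A₁ * (6 * n : ℕ)) :=
            mul_le_mul_of_nonneg_left h6 (div_nonneg hM0 hnpos.le)
        _ = 6 * M * A₁ := by
            push_cast
            rw [div_mul_eq_mul_div, div_eq_iff hnpos.ne']; ring
    rw [hB, le_div_iff₀ hspos]
    linarith
  have hgB : ∀ n : ℕ, g n ≤ B := by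
    intro n
    rcases Nat.eq_zero_or_pos n with h | h
    · exact (hgmono (Nat.zero_le 1) |>.trans' (by rw [h])).trans (round2 1 le_rfl)
    · exact round2 n h
  -- ### contradiction with `Σ G = ∞`
  refine hGns (summable_of_sum_le (c := B) (fun x => hG0 x) fun t => ?_)
  set N : ℕ := t.sup Site.supNorm with hN
  have ht : t ⊆ box d N := fun u hu => by
    rw [mem_box_iff_supNorm_le]; exact Finset.le_sup (f := Site.supNorm) hu
  exact (Finset.sum_le_sum_of_subset_of_nonneg ht fun u _ _ => hG0 u).trans (hgB N)

end Critical

end Literature.Barriers.CriticalPhenomena.SpreadOutIsing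

end
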